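import Mathlib
import Summits.Langlands.Langlands.Theorems.SoloBlindCyclicPowers

/-!
# Fourth powers modulo primes `p ≡ 3 (mod 4)`; `2` is a fourth power modulo `p ≡ 7 (mod 8)`

Solo side programme O1b (four-cell law, cell `(a₂, a_N) = (−, +)`): the residue condition
"`x ^ 4 ≡ 2 (mod N)` is solvable" coincides with `(2/N)₄ = 1` for `N ≡ 1 (mod 8)` and holds
automatically for `N ≡ 7 (mod 8)`, because for a prime `p ≡ 3 (mod 4)` the group of squares in
`(ZMod p)ˣ` has odd order, so every square is a fourth power.  Both facts are derived here from the
cyclic-group criterion `SoloBlindCyclicPowers.exists_pow_eq_iff_pow_div_gcd_eq_one`.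
-/

set_option linter.dupNamespace false

namespace Summit.Langlands.Langlands.Theorems.SoloBlindFourthPowers

open Summit.Langlands.Langlands.Theorems.SoloBlindCyclicPowers

/-- For a prime `p ≡ 3 (mod 4)`, a unit modulo `p` is a fourth power iff it is a square. -/
theorem exists_pow_four_eq_iff_exists_sq_eq {p : ℕ} [Fact p.Prime] (hp : p % 4 = 3)
    (x : (ZMod p)ˣ) : (∃ y : (ZMod p)ˣ, y ^ 4 = x) ↔ ∃ y : (ZMod p)ˣ, y ^ 2 = x := by
  have hcard : Fintype.card (ZMod p)ˣ = p - 1 := ZMod.card_units p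
  have hmod : (p - 1) % 4 = 2 := by omega
  have h4 : Nat.gcd (p - 1) 4 = 2 := by
    rw [Nat.gcd_comm, Nat.gcd_rec, hmod]; norm_num
  have h2 : Nat.gcd (p - 1) 2 = 2 := by
    rw [Nat.gcd_comm, Nat.gcd_rec]
    have : (p - 1) % 2 = 0 := by omega
    rw [this]; norm_num
  rw [exists_pow_eq_iff_pow_div_gcd_eq_one x 4, exists_pow_eq_iff_pow_div_gcd_eq_one x 2, hcard, h4, h2]

/-- For a prime `p ≡ 7 (mod 8)`, `2` is a fourth power modulo `p`. -/
theorem exists_pow_four_eq_two {p : ℕ} [Fact p.Prime] (hp : p % 8 = 7) :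
    ∃ y : ZMod p, y ^ 4 = 2 := by
  have hprime : p.Prime := Fact.out
  have hp2 : p ≠ 2 := by
    intro h; subst h; norm_num at hp
  have hsq : IsSquare (2 : ZMod p) := (ZMod.exists_sq_eq_two_iff hp2).mpr (Or.inr hp)
  have h2ne : (2 : ZMod p) ≠ 0 := by
    have h : ((2 : ℕ) : ZMod p) ≠ 0 := by
      rw [ne_eq, ZMod.natCast_eq_zero_iff]
      intro hd
      have := (Nat.prime_dvd_prime_iff_eq hprime Nat.prime_two).mp hd
      exact hp2 this
    exact_mod_cast h
  obtain ⟨r, hr⟩ := hsq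
  have hr0 : r ≠ 0 := by
    intro h0; rw [h0, mul_zero] at hr; exact h2ne hr
  have hsqU : ∃ y : (ZMod p)ˣ, y ^ 2 = Units.mk0 (2 : ZMod p) h2ne := by
    refine ⟨Units.mk0 r hr0, ?_⟩
    ext
    rw [Units.val_pow_eq_pow_val, Units.val_mk0, Units.val_mk0, pow_two]
    exact hr.symm
  obtain ⟨y, hy⟩ := (exists_pow_four_eq_iff_exists_sq_eq (p := p) (by omega) _).mpr hsqU
  refine ⟨(y : ZMod p), ?_⟩
  rw [← Units.val_pow_eq_pow_val, hy, Units.val_mk0]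

/-- The solvability criterion in the form used by the four-cell law: for `p ≡ 7 (mod 8)` every
square unit is a fourth power and `2` is one of them. -/
theorem isSquare_two_and_fourth_power {p : ℕ} [Fact p.Prime] (hp : p % 8 = 7) :
    IsSquare (2 : ZMod p) ∧ ∃ y : ZMod p, y ^ 4 = 2 :=
  ⟨(ZMod.exists_sq_eq_two_iff (by intro h; subst h; norm_num at hp)).mpr (Or.inr hp),
   exists_pow_four_eq_two hp⟩

end Summit.Langlands.Langlands.Theorems.SoloBlindFourthPowers
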